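import Summits.AtomisticToContinuum.BoseEinsteinCondensation.Theses.BECInfraredBound
import Summits.AtomisticToContinuum.BoseEinsteinCondensation.Theorems.BECInfraredBoundBecUvTailKineticBudget
import Summits.AtomisticToContinuum.BoseEinsteinCondensation.Theorems.BECInfraredBoundBecUvTailOccupationWindow
import Summits.AtomisticToContinuum.BoseEinsteinCondensation.Theorems.BECInfraredBoundBecUvTailOneBodyTail
import Summits.AtomisticToContinuum.BoseEinsteinCondensation.Theorems.BECInfraredBoundBecUvTailLiftOneBody
import Summits.AtomisticToContinuum.BoseEinsteinCondensation.Theorems.BECInfraredBoundBecUvTailTailArithmetic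

/-!
# `BecUvTail` (stmt-AtomisticToContinuum-8823): the summed ultraviolet tail of the inner-box
# plane-wave occupations of Dirichlet near-minimisers is `≤ θN`, `θ < 1`

Route `BECInfraredBound` of `AtomisticToContinuum/BoseEinsteinCondensation`, crux 3 (rank 3).
For every repulsive finite-range `v` there are `K > 0` and `θ < 1` such that for every
`ε ∈ (0,1/4)`, all small `ρ`, all large `N`, some `δ > 0` and every `δ`-near-minimiser `Ψ` in the
Dirichlet box of side `L = (N/ρ)^{1/3}`,
`Σ_{‖k‖∞ > K√ρ·L} ⟨φ'_k, γ_Ψ φ'_k⟩ ≤ θ N`, `φ'_k = L'^{-3/2} e^{2πik·x/L'} 1_{Λ'}`,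
`Λ' = (εL, L−εL)³`, `L' = (1−2ε)L` (sup norm on `k ∈ ℤ³`; `ℝ≥0∞`-valued `tsum` over the subtype).

This file is the sorry-free form of the lead's crux skeleton `Cruxes/BecUvTail/Lines/Sketch.lean`
(line `Sketch`, collar mechanism on birth's seam); its seven registered stubs are the theorems
`BecUvTail.stub_*` of the imported helper files, and the composition below is the skeleton's
kernel-checked `BecUvTail_of`:

* `stub_kineticBudget` — a-priori kinetic budget `∫|∇Ψ|² ≤ CρN` of `δ`-near-minimisers (Dyson's
  upper bound `E₀ ≤ 4πρa(1+O((ρa³)^{1/3}))N`, and `E₀ = o(N)` when `a = 0`);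
* `stub_oneBodyTail` — the one-body inequality `ℓ³Σ_{‖n‖∞>K'}|ĉ_n u|² ≤ c₀∫_cell|u|² + A(ℓ/K')²∫_cell|∇u|²`
  (`c₀ = 1/2`; collar cut-off `stub_cutoff`, support-Chebyshev, Parseval, collar mass `stub_collarMass`);
* `stub_occupationWindow` + `stub_liftOneBody` — the window occupations are `ℓ³|ĉ_k|²` of the
  translated slices, integrated over the spectators with Bose symmetry `T = N∫|∇₀Ψ|²`:
  `Σ_{‖k‖∞>K'} ⟨φ'_k,γ_Ψφ'_k⟩ ≤ c₀N + A((1−2ε)L/K')² T`;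
* `stub_tailArithmetic` — with `T ≤ CρN`, `K' = K√ρL ≥ M` eventually and `K² ≥ 2AC/(1−c₀)`:
  tail `≤ (c₀ + AC/K²)N ≤ θN`, `θ = (1+c₀)/2`.

References: LSSY2005 §1.2 (1.17), Thm 2.2, Ch. 5; the momentum-localisation inequality itself is
elementary and unprinted in this form (refuter/grounder record on the item).
-/

noncomputable section

open Filter
open scoped ENNReal NNReal BigOperators

namespace Summit.AtomisticToContinuum.BoseEinsteinCondensation.Theorems

/-- **Crux `BecUvTail` of route `BECInfraredBound`** (stmt-AtomisticToContinuum-8823): the summed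
occupation of the inner-box plane waves beyond the infrared window `‖k‖∞ > K√ρ·L` in every
`δ`-near-minimiser is at most `θN` with `θ < 1`, for every repulsive finite-range interaction, every
`ε ∈ (0,1/4)`, all small densities and all large `N`. Composition of the registered stubs of line
`Sketch`: the one-body tail constants `c₀, A, M` (`stub_oneBodyTail`) feed the `N`-body lift
(`stub_liftOneBody`, with the window identity `stub_occupationWindow`) and the arithmetic
(`stub_tailArithmetic`), which returns `K, θ` for the kinetic budget constant `C` of
`stub_kineticBudget`; `ρ₀` and `δ` are the budget's, and the two eventualities in `N` are intersected.
[folklore] -/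
theorem BecUvTail_proof :
    Summit.AtomisticToContinuum.BoseEinsteinCondensation.Theses.BECInfraredBound.BecUvTail := by
  intro v hv
  obtain ⟨C, hC, ρ₀, hρ₀, H1⟩ := BecUvTail.stub_kineticBudget v hv
  obtain ⟨c₀, hc₀, hc₁, A, hA, M, hM, hOne⟩ := BecUvTail.stub_oneBodyTail
  obtain ⟨K, hK, θ, hθ, H2⟩ := BecUvTail.stub_tailArithmetic c₀ A M hc₀ hc₁ hA hM
    (BecUvTail.stub_liftOneBody c₀ A M hc₀ hA hOne BecUvTail.stub_occupationWindow) C hC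
  refine ⟨K, hK, θ, hθ, fun ε hε hε4 => ⟨ρ₀, hρ₀, fun ρ hρ hρρ₀ => ?_⟩⟩
  filter_upwards [H1 ρ hρ hρρ₀, H2 ε hε hε4 ρ hρ] with N hN1 hN2
  obtain ⟨δ, hδ, hΨ⟩ := hN1
  exact ⟨δ, hδ, fun Ψ hE => hN2 Ψ (hΨ Ψ hE)⟩

end Summit.AtomisticToContinuum.BoseEinsteinCondensation.Theorems

end
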